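import Literature.NumberTheory.EllipticCurves.CMTorsionIrreducibleOrdinaryProofs
import Literature.NumberTheory.EllipticCurves.QuadraticBaseChangeGaloisProofs
import Literature.NumberTheory.EllipticCurves.IsogenyGeomEndRingQuadraticProofs
import Literature.NumberTheory.EllipticCurves.IsogenyGeomEndRingProofs
import Literature.NumberTheory.EllipticCurves.IsogenyHomProofs
import Literature.NumberTheory.EllipticCurves.ComplexMultiplicationHasCMProofs
import Literature.NumberTheory.EllipticCurves.BSDInvariantsProofs
import Literature.NumberTheory.EllipticCurves.PointDivisibilityProofs
import Literature.NumberTheory.EllipticCurves.TwoIsogenyTorsor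
import Literature.NumberTheory.EllipticCurves.Rank1Residual.CMFieldDecompositionProofs
import Summits.BirchSwinnertonDyer.BirchSwinnertonDyer.Theorems.PrintCFramBottomClassIndexLawFiveLeTransferCoprimeTwist
import HarnessLib

/-!
# Route `QuadraticBranchSignedControl` (rung K8, cell `bsd-potss`): crux stmt-BirchSwinnertonDyer-19606
# `PlusEtaMainConjectureNonsurj` — THE CM TWISTING CHARACTER IDENTIFIED ON `√d_K ∈ ℚ̄`: for every CM curve `A/ℚ` and
# every prime `p`, a `√D` visible on `A[p]` whose quadratic character is the KUMMER character of `√d_K`,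
# `d_K = cmFieldDiscrOfJ (j A)` one of the nine class-number-one discriminants

WHAT. k8eta-c2 g9/g10 (`…CartanFieldCMAnchor`, `…CartanFieldCMTwist`) proved that a CM(-curve) anchor `A` of a row `V` of
crux 19606 pins the Cartan subgroup `H_V` to `ker χ`, `χ` the quadratic character twisting a CM endomorphism `√D` of `A`
(Lang's Remark) — and recorded as NOT proved «that `ker χ` is `Γ_{ℚ(√D)}` as a statement about `√D ∈ ℚ̄`»: the tree phrases
Lang's Remark through an abstract `χ`. This file supplies the identification, WITHOUT the tangent representation: instead of
Lang's `ψ = 2φ₀ − t` it builds the CM endomorphism as **`[√d_K] = ι ∘ φ`** (Silverman, *Advanced Topics*, II §2,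
Prop. II.2.3.1), where `φ : A' → A'^{(d_K)}` is the `ℚ`-ISOGENY onto the quadratic twist by the CM discriminant (Milne 1972
Thm. 3 / Burungale–Flach 2024 Cor. 2, in the tree for all thirteen `j`: `PrintCFram.RelativeAnchorTransfer.
isIsogenous_quadraticTwist_cmFieldDiscrOfJ`) on the model `A' = C • A` with `a₁ = a₃ = 0`, and `ι : A'^{(d)}(ℚ̄) ≃ A'(ℚ̄)`,
`(x, y) ↦ (x/d, y/(d√d))`, is the twisting isomorphism over `ℚ(√d)` (`untwistEquiv`). Its twisting character is the Kummer
character of `√d_K` BY CONSTRUCTION (`untwistEquiv_smul_of_eq{_neg}`):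

* §1 generalities: an endomorphism with finite kernel is `≠ 0`; one killing `m·A(ℚ̄)` is `0`; **a geometric endomorphism
  anti-commuting with some `σ₀ ∈ Γ_ℚ` squares to a negative integer** (`exists_sq_eq_neg_of_mem_geomEndRing_of_anticommute`:
  the integral quadratic relation `x² − tx + n = 0` of *AEC* III.9 conjugated by `σ₀` gives `2t·x = 0`, so `t = 0`); the
  `p`-DESCENT to visibility for an arbitrary twisted `√D` (`exists_visible_of_sqrt_twist`, *AEC* §VIII.2).
* §2 `[√d] = ι ∘ φ`: twisted by the Kummer character (`untwistEquiv_isogeny_smul`), geometric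
  (`untwistEquiv_comp_isogeny_mem_geomEndRing`), non-zero; hence `exists_visible_sqrt_twist_kummer_of_isogeny_quadraticTwist`.
* §3 **`exists_visible_sqrt_twist_kummer_of_hasCM`**: for EVERY elliptic `A/ℚ` with CM and every prime `p` — `ψ`, `D < 0`,
  `χ ≠ 1` with `ψ² = D`, `ψ(σP) = χ(σ)·σψ(P)`, `ψ` visible on `A[p]`, and **`χ(σ) = 1 ⟺ σ√d_K = √d_K`**; transported from
  `C • A` along the `Γ_ℚ`-equivariant `geomPointsEquiv`. Also `cmFieldDiscrOfJ_mem_nine_of_hasCM` / `…_neg_of_hasCM`.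

The row-level consequences (`K_V = ℚ(√d_K)` for a CM-anchored row; the kernel door of the v7 stub «uncongruent») are in the
sibling `…PlusEtaNonsurjCartanFieldCMField`.

HONEST FRAMING (cell `bsd-potss`, run/shared/lean/pub/bsd-potss/; FULL-BSD rank ≤ 1 programme): TOOL THEOREMS ONLY (no definition,
no named fact, no `sorry`, axioms standard); route-free (about CM curves over `ℚ`). Nothing is booked; crux 19606 stays OPEN;
`BSD(W, p)` is claimed for no pair. Seat `bsd-potss-k8eta-c2` g14 (prover), `--supports stmt-BirchSwinnertonDyer-19606`.

References: [Lang1987] Ch. 10 §4 (Remark); [SilvermanAdvancedTopics1994] Thm. II.2.2(a), Prop. II.2.3.1, App. A §3;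
[SilvermanAEC2009] III.4, Cor. III.6.3, III.9, §VIII.2, X.5 Cor. 5.4; [BurungaleFlach2024] proof of Cor. 2 (Milne 1972 Thm. 3).
-/

set_option autoImplicit false
set_option linter.dupNamespace false

noncomputable section

open scoped Classical

open Field WeierstrassCurve Literature.NumberTheory.EllipticCurves Literature.NumberTheory.EllipticCurves.Rank1Residual

namespace Summit.BirchSwinnertonDyer.BirchSwinnertonDyer.Theorems.EtaCartanField

/-! ## §1 Generalities on additive endomorphisms of `A(ℚ̄)` -/

section General

variable {A : WeierstrassCurve ℚ} [A.IsElliptic]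

/-- An additive endomorphism of `A(ℚ̄)` with finite kernel is non-zero (`A(ℚ̄)` is infinite). [folklore] -/
theorem addMonoidEnd_ne_zero_of_finite_ker {x : AddMonoid.End A.geomPoints}
    (hker : ((x : A.geomPoints →+ A.geomPoints).ker : Set A.geomPoints).Finite) : x ≠ 0 := by
  intro hx
  have huniv : ((x : A.geomPoints →+ A.geomPoints).ker : Set A.geomPoints) = Set.univ := by
    ext P
    simp only [SetLike.mem_coe, AddMonoidHom.mem_ker, Set.mem_univ, iff_true]
    rw [hx]
    rfl
  rw [huniv] at hker
  exact Set.infinite_univ (α := A.geomPoints) hker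

/-- If an additive endomorphism `x` of `A(ℚ̄)` kills `m • A(ℚ̄)` for some `m ≠ 0`, then `x = 0`
(multiplication by `m` is onto `A(ℚ̄)`, Silverman *AEC* §VIII.2). [cite: SilvermanAEC2009, §VIII.2] -/
theorem addMonoidEnd_eq_zero_of_forall_zsmul {x : AddMonoid.End A.geomPoints} {m : ℤ} (hm : m ≠ 0)
    (h : ∀ P : A.geomPoints, m • x P = 0) : x = 0 := by
  refine AddMonoidHom.ext fun Q => ?_
  obtain ⟨P, rfl⟩ := A.zsmul_geomPoints_surjective_holds hm Q
  change x (m • P) = 0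
  rw [map_zsmul]
  exact h P

/-- **A geometric endomorphism anti-commuting with some Galois element is a square root of a negative
integer.** Let `x ∈ End_{ℚ̄}(A)` be non-zero with `x(σ₀P) = −σ₀x(P)` for some `σ₀ ∈ Γ_ℚ` and all `P`. By
Silverman *AEC* III.9 / Cor. III.6.3 (the tree's `exists_int_quadratic_of_mem_geomEndRing`) `x² − t x + n = 0`
with `m² + tmk + nk² > 0` off `m + kx = 0`; conjugating the relation by `σ₀` flips the sign of `t`, so
`2t·x = 0`, whence `t = 0` (`[2t]` is onto `A(ℚ̄)`), `x² = −n` and `n > 0`. [cite: SilvermanAEC2009, Cor. III.6.3 and III.9] -/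
theorem exists_sq_eq_neg_of_mem_geomEndRing_of_anticommute {x : AddMonoid.End A.geomPoints}
    (hx : x ∈ A.geomEndRing) (hx0 : x ≠ 0) {σ₀ : absoluteGaloisGroup ℚ}
    (hanti : ∀ P : A.geomPoints, x (σ₀ • P) = -(σ₀ • x P)) :
    ∃ D : ℤ, D < 0 ∧ ∀ P : A.geomPoints, x (x P) = D • P := by
  obtain ⟨t, n, hrel, hpos⟩ := A.exists_int_quadratic_of_mem_geomEndRing hx
  have hrelP : ∀ P : A.geomPoints, x (x P) - t • x P + n • P = 0 := fun P => by
    have := congrArg (fun f : AddMonoid.End A.geomPoints => f P) hrel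
    change (x * x - (t : AddMonoid.End A.geomPoints) * x) P + (n : AddMonoid.End A.geomPoints) P = 0 at this
    rw [AddMonoid.End.intCast_apply] at this
    change (x * x) P - ((t : AddMonoid.End A.geomPoints) * x) P + n • P = 0 at this
    rwa [AddMonoid.End.coe_mul, Function.comp_apply, AddMonoid.End.coe_mul, Function.comp_apply,
      AddMonoid.End.intCast_apply] at this
  -- conjugating by `σ₀`: `x² + t x + n = 0`
  have hrelP' : ∀ P : A.geomPoints, x (x P) + t • x P + n • P = 0 := fun P => by
    have h1 := hrelP (σ₀ • P)
    rw [hanti, map_neg, hanti, neg_neg, zsmul_neg, sub_neg_eq_add, ← smul_comm σ₀ t (x P), ← smul_comm σ₀ n P,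
      ← smul_add, ← smul_add] at h1
    simpa using (smul_eq_zero_iff_eq σ₀).mp h1
  -- hence `2t · x = 0`, so `t = 0`
  have ht : t = 0 := by
    by_contra ht
    apply hx0
    refine addMonoidEnd_eq_zero_of_forall_zsmul (m := 2 * t) (mul_ne_zero two_ne_zero ht) fun P => ?_
    have h := sub_eq_zero.mpr ((hrelP' P).trans (hrelP P).symm)
    rw [show x (x P) + t • x P + n • P - (x (x P) - t • x P + n • P) = (2 * t) • x P by
      rw [mul_zsmul, two_zsmul]; abel] at h
    exact h
  refine ⟨-n, ?_, fun P => ?_⟩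
  · have h := hpos 0 1 (by
      rw [Int.cast_zero, Int.cast_one, zero_add, one_mul]; exact hx0)
    simp only [ht] at h
    omega
  · have h := hrelP P
    rw [ht, zero_zsmul, sub_zero, ← eq_neg_iff_add_eq_zero, ← neg_zsmul] at h
    exact h

/-- **`p`-descent to visibility.** An additive endomorphism `ψ` of `A(ℚ̄)` with `ψ ∘ ψ = D < 0`, twisted by
`χ : Γ_ℚ → {±1}`, can be replaced by one with the same twisting character which is VISIBLE on `A[p]`
(divide by `[p]` as long as `ψ` vanishes on `A[p]`; `|D|` drops: the tree's
`exists_sqrt_twist_div_of_forall_apply_eq_zero`, Silverman *AEC* §VIII.2). The argument of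
`WeierstrassCurve.exists_sqrt_twist_apply_ne_zero_of_hasCM`, for an ARBITRARY twisted `ψ`.
[cite: SilvermanAEC2009, §VIII.2 (sequence 0 → E[m] → E(K̄) → E(K̄) → 0)] -/
theorem exists_visible_of_sqrt_twist {ψ : AddMonoid.End A.geomPoints} {D : ℤ} (hD : D < 0)
    (hψψ : ∀ P : A.geomPoints, ψ (ψ P) = D • P) {χ : absoluteGaloisGroup ℚ →* ℤˣ}
    (hrel : ∀ (σ : absoluteGaloisGroup ℚ) (P : A.geomPoints), ψ (σ • P) = ((χ σ : ℤˣ) : ℤ) • σ • ψ P)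
    {p : ℕ} (hp : p.Prime) :
    ∃ (ψ' : AddMonoid.End A.geomPoints) (D' : ℤ), D' < 0 ∧
      (∀ P : A.geomPoints, ψ' (ψ' P) = D' • P) ∧
      (∀ (σ : absoluteGaloisGroup ℚ) (P : A.geomPoints), ψ' (σ • P) = ((χ σ : ℤˣ) : ℤ) • σ • ψ' P) ∧
      ∃ P₀ : A.geomPoints, (p : ℤ) • P₀ = 0 ∧ ψ' P₀ ≠ 0 := by
  suffices key : ∀ (n : ℕ) (D : ℤ) (ψ : AddMonoid.End A.geomPoints), D.natAbs = n → D < 0 →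
      (∀ P : A.geomPoints, ψ (ψ P) = D • P) →
      (∀ (σ : absoluteGaloisGroup ℚ) (P : A.geomPoints), ψ (σ • P) = ((χ σ : ℤˣ) : ℤ) • σ • ψ P) →
      ∃ (ψ' : AddMonoid.End A.geomPoints) (D' : ℤ), D' < 0 ∧
        (∀ P : A.geomPoints, ψ' (ψ' P) = D' • P) ∧
        (∀ (σ : absoluteGaloisGroup ℚ) (P : A.geomPoints), ψ' (σ • P) = ((χ σ : ℤˣ) : ℤ) • σ • ψ' P) ∧
        ∃ P₀ : A.geomPoints, (p : ℤ) • P₀ = 0 ∧ ψ' P₀ ≠ 0 from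
    key _ D ψ rfl hD hψψ hrel
  intro n
  induction n using Nat.strong_induction_on with
  | _ n ih =>
    intro D ψ hn hD hψψ hrel
    by_cases hvis : ∃ P₀ : A.geomPoints, (p : ℤ) • P₀ = 0 ∧ ψ P₀ ≠ 0
    · exact ⟨ψ, D, hD, hψψ, hrel, hvis⟩
    · push Not at hvis
      obtain ⟨ψ₁, D₁, hDD₁, -, hψ₁ψ₁, hrel₁⟩ := A.exists_sqrt_twist_div_of_forall_apply_eq_zero hψψ hrel hp hvis
      have hD₁ : D₁ < 0 := by
        by_contra hge
        push Not at hge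
        have : 0 ≤ (p : ℤ) ^ 2 * D₁ := mul_nonneg (by positivity) hge
        omega
      have hlt : D₁.natAbs < n := by
        rw [← hn, hDD₁, Int.natAbs_mul, Int.natAbs_pow]
        have h1 : 1 < (p : ℤ).natAbs ^ 2 := by
          rw [Int.natAbs_natCast]
          nlinarith [hp.two_le]
        have h2 : 0 < D₁.natAbs := Int.natAbs_pos.mpr hD₁.ne
        nlinarith
      exact ih _ hlt D₁ ψ₁ rfl hD₁ hψ₁ψ₁ hrel₁

end General

/-! ## §2 The CM endomorphism `[√d] = ι ∘ φ` on a model with `a₁ = a₃ = 0`, and its Kummer twist -/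

section SqrtEndo

variable {A : WeierstrassCurve ℚ} [A.IsCharNeTwoNF] {d : ℚ} (hd : d ≠ 0)

/-- **`[√d] := ι ∘ φ` is twisted by the Kummer character of `√d`.** For an isogeny `φ : A → A^{(d)}` over `ℚ`
and the `ℚ̄`-isomorphism `ι : A^{(d)}(ℚ̄) ≃ A(ℚ̄)`, `(x, y) ↦ (x/d, y/(d√d))` (`untwistEquiv`), and any
`χ : Γ_ℚ → {±1}` with `χ(σ) = ±1` according as `σ√d = ±√d`: `ι(φ(σP)) = χ(σ)·σ·ι(φ(P))` — `φ` is `Γ_ℚ`-equivariant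
and `ι` is equivariant up to the sign of `σ` on `√d` (odd power `(√d)³` in the `y`-coordinate). This is Silverman,
*Advanced Topics*, II §2 (`[√d] = τ ∘ φ`, Prop. II.2.3.1) read with Thm. II.2.2(a): `[√d]^σ = [σ√d]`.
[cite: SilvermanAdvancedTopics1994, Prop. II.2.3.1 and Thm. II.2.2(a)] [cite: SilvermanAEC2009, X.5 Cor. 5.4] -/
theorem untwistEquiv_isogeny_smul (φ : Isogeny A (A.quadraticTwist d)) {χ : absoluteGaloisGroup ℚ →* ℤˣ}
    (h1 : ∀ σ : absoluteGaloisGroup ℚ, σ • geomSqrt d = geomSqrt d → χ σ = 1)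
    (h2 : ∀ σ : absoluteGaloisGroup ℚ, σ • geomSqrt d = -geomSqrt d → χ σ = -1)
    (σ : absoluteGaloisGroup ℚ) (P : A.geomPoints) :
    untwistEquiv A hd (φ (σ • P)) = ((χ σ : ℤˣ) : ℤ) • σ • untwistEquiv A hd (φ P) := by
  rw [Isogeny.map_smul]
  rcases smul_geomSqrt_eq_or σ d with hσ | hσ
  · rw [untwistEquiv_smul_of_eq A hd σ hσ, h1 σ hσ, Units.val_one, one_zsmul]
  · rw [untwistEquiv_smul_of_eq_neg A hd σ hσ, h2 σ hσ, Units.val_neg, Units.val_one, neg_one_zsmul]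

/-- **`[√d] = ι ∘ φ` is a geometric endomorphism** (`∈ End_{ℚ̄}(A)`): the isogeny is algebraic and so is the
`ℚ̄`-isomorphism `ι` (`isAlgebraicOn_pointEquiv_trans_congrEquiv`), hence so is the composite (`IsAlgebraicOn.comp`).
[cite: SilvermanAEC2009, III.4 (End(E)) and III.1 Table 3.1] -/
theorem untwistEquiv_comp_isogeny_mem_geomEndRing (φ : Isogeny A (A.quadraticTwist d)) :
    ((untwistEquiv A hd).toAddMonoidHom.comp φ.toAddMonoidHom : AddMonoid.End A.geomPoints) ∈ A.geomEndRing := by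
  refine Subring.subset_closure ?_
  have hι : IsAlgebraicOn (A.quadraticTwist d) A (fun P => untwistEquiv A hd P) :=
    isAlgebraicOn_pointEquiv_trans_congrEquiv (untwist hd) (untwist_smul_eq A hd)
  exact IsAlgebraicOn.comp (f := (untwistEquiv A hd).toAddMonoidHom) (g := φ.toAddMonoidHom) hι φ.isAlgebraic

/-- `[√d] = ι ∘ φ` has finite kernel (that of `φ`), hence is non-zero. [folklore] -/
theorem untwistEquiv_comp_isogeny_ne_zero [A.IsElliptic] (φ : Isogeny A (A.quadraticTwist d)) :
    ((untwistEquiv A hd).toAddMonoidHom.comp φ.toAddMonoidHom : AddMonoid.End A.geomPoints) ≠ 0 := by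
  refine addMonoidEnd_ne_zero_of_finite_ker (φ.finite_ker.subset fun P hP => ?_)
  simp only [SetLike.mem_coe, AddMonoidHom.mem_ker] at hP ⊢
  change untwistEquiv A hd (φ.toAddMonoidHom P) = 0 at hP
  exact (untwistEquiv A hd).map_eq_zero_iff.mp hP

include hd in
/-- **`[√d]² = D < 0` and visibility on `A[p]`, with the KUMMER twisting character.** For `A/ℚ` (model with
`a₁ = a₃ = 0`), `d ∈ ℚ^×` NOT a square in `ℚ`, and an isogeny `φ : A → A^{(d)}` over `ℚ`: for every prime `p` there
are an additive endomorphism `ψ` of `A(ℚ̄)`, `D < 0` with `ψ ∘ ψ = D`, and a character `χ : Γ_ℚ → {±1}` with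
`ψ(σP) = χ(σ)·σψ(P)`, `ψ` visible on `A[p]`, and **`χ(σ) = 1 ⟺ σ√d = √d`**. (`[√d] = ι ∘ φ` anti-commutes with any
`σ₀` moving `√d`, so squares to a negative integer by `exists_sq_eq_neg_of_mem_geomEndRing_of_anticommute`; then
`p`-descent.) [cite: SilvermanAdvancedTopics1994, Prop. II.2.3.1 and Thm. II.2.2(a)] [cite: SilvermanAEC2009, §VIII.2] -/
theorem exists_visible_sqrt_twist_kummer_of_isogeny_quadraticTwist [A.IsElliptic] (φ : Isogeny A (A.quadraticTwist d))
    (hdsq : ∀ q : ℚ, d ≠ q * q) {p : ℕ} (hp : p.Prime) :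
    ∃ (ψ : AddMonoid.End A.geomPoints) (D : ℤ) (χ : absoluteGaloisGroup ℚ →* ℤˣ),
      D < 0 ∧ (∀ P : A.geomPoints, ψ (ψ P) = D • P) ∧ (∃ σ : absoluteGaloisGroup ℚ, χ σ ≠ 1) ∧
      (∀ (σ : absoluteGaloisGroup ℚ) (P : A.geomPoints), ψ (σ • P) = ((χ σ : ℤˣ) : ℤ) • σ • ψ P) ∧
      (∃ P₀ : A.geomPoints, (p : ℤ) • P₀ = 0 ∧ ψ P₀ ≠ 0) ∧
      ∀ σ : absoluteGaloisGroup ℚ, χ σ = 1 ↔ σ • geomSqrt d = geomSqrt d := by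
  obtain ⟨χ, h1, h2, -⟩ := exists_quadraticCharacter hd ℤ
  -- some `σ₀` moves `√d` (Galois descent: otherwise `√d ∈ ℚ`)
  obtain ⟨σ₀, hσ₀⟩ : ∃ σ₀ : absoluteGaloisGroup ℚ, σ₀ • geomSqrt d = -geomSqrt d := by
    by_contra hall
    push Not at hall
    have hfix : ∀ σ : absoluteGaloisGroup ℚ, TwoIsogenyTorsor.galAut ℚ σ (geomSqrt d) = geomSqrt d := fun σ =>
      (smul_geomSqrt_eq_or σ d).resolve_right (hall σ)
    obtain ⟨c, hc⟩ := TwoIsogenyTorsor.exists_algebraMap_eq_of_forall_galAut hfix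
    have hc2 := congrArg (fun z : AlgebraicClosure ℚ => z ^ 2) hc
    rw [← map_pow, geomSqrt_sq] at hc2
    exact hdsq c (by rw [← pow_two]; exact (RingHom.injective _ hc2).symm)
  have hχ : ∃ σ : absoluteGaloisGroup ℚ, χ σ ≠ 1 := ⟨σ₀, by rw [h2 σ₀ hσ₀]; decide⟩
  have hiff : ∀ σ : absoluteGaloisGroup ℚ, χ σ = 1 ↔ σ • geomSqrt d = geomSqrt d := fun σ =>
    ⟨fun h => (smul_geomSqrt_eq_or σ d).resolve_right fun hσ => by rw [h2 σ hσ] at h; exact absurd h (by decide),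
      h1 σ⟩
  set x : AddMonoid.End A.geomPoints := (untwistEquiv A hd).toAddMonoidHom.comp φ.toAddMonoidHom with hxdef
  have hxapply : ∀ P : A.geomPoints, x P = untwistEquiv A hd (φ P) := fun P => rfl
  have hrel : ∀ (σ : absoluteGaloisGroup ℚ) (P : A.geomPoints), x (σ • P) = ((χ σ : ℤˣ) : ℤ) • σ • x P :=
    fun σ P => by rw [hxapply, hxapply, untwistEquiv_isogeny_smul hd φ h1 h2]
  have hanti : ∀ P : A.geomPoints, x (σ₀ • P) = -(σ₀ • x P) := fun P => by
    rw [hrel, h2 σ₀ hσ₀, Units.val_neg, Units.val_one, neg_one_zsmul]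
  obtain ⟨D, hD, hxx⟩ := exists_sq_eq_neg_of_mem_geomEndRing_of_anticommute
    (untwistEquiv_comp_isogeny_mem_geomEndRing hd φ) (untwistEquiv_comp_isogeny_ne_zero hd φ) hanti
  obtain ⟨ψ, D', hD', hψψ, hrel', hvis⟩ := exists_visible_of_sqrt_twist hD hxx hrel hp
  exact ⟨ψ, D', χ, hD', hψψ, hχ, hrel', hvis, hiff⟩

end SqrtEndo

/-! ## §3 Every CM curve over `ℚ`: a visible `√D` whose twisting character is the Kummer character of `√d_K` -/

section CM

/-- The inverse of a `Γ_ℚ`-equivariant additive isomorphism is equivariant. [folklore] -/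
private theorem addEquiv_symm_smul {A B : WeierstrassCurve ℚ} (T : A.geomPoints ≃+ B.geomPoints)
    (hT : ∀ (σ : absoluteGaloisGroup ℚ) (P : A.geomPoints), T (σ • P) = σ • T P)
    (σ : absoluteGaloisGroup ℚ) (Q : B.geomPoints) : T.symm (σ • Q) = σ • T.symm Q := by
  apply T.injective
  rw [T.apply_symm_apply, hT, T.apply_symm_apply]

/-- **The nine class-number-one discriminants.** The CM field discriminant `d_K = cmFieldDiscrOfJ (j A)` of a CM
elliptic curve `A/ℚ` is one of `−3, −4, −7, −8, −11, −19, −43, −67, −163` (Silverman, *Advanced Topics*, App. A §3;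
the tree's `hasCM_iff_j_mem_holds` and `cmFieldDiscrOfJ_mem_of_mem_cmJInvariants`).
[cite: SilvermanATAEC1994, App. A §3 (table of CM j-invariants)] -/
theorem cmFieldDiscrOfJ_mem_nine_of_hasCM (A : WeierstrassCurve ℚ) [A.IsElliptic] (hCM : A.HasCM) :
    cmFieldDiscrOfJ A.j ∈ ({-3, -4, -7, -8, -11, -19, -43, -67, -163} : Finset ℤ) :=
  cmFieldDiscrOfJ_mem_of_mem_cmJInvariants ((hasCM_iff_j_mem_holds A).mp hCM)

/-- The CM field discriminant of a CM curve over `ℚ` is negative. [cite: SilvermanATAEC1994, App. A §3 (table of CM j-invariants)] -/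
theorem cmFieldDiscrOfJ_neg_of_hasCM (A : WeierstrassCurve ℚ) [A.IsElliptic] (hCM : A.HasCM) :
    cmFieldDiscrOfJ A.j < 0 := by
  have h := cmFieldDiscrOfJ_mem_nine_of_hasCM A hCM
  simp only [Finset.mem_insert, Finset.mem_singleton] at h
  rcases h with h | h | h | h | h | h | h | h | h <;> rw [h] <;> norm_num

/-- **Lang's Remark with the character IDENTIFIED: for a CM curve `A/ℚ` the twisting character of a (visible) `√D` is the
Kummer character of `√d_K`, `d_K = cmFieldDiscrOfJ (j A)`.** For every elliptic `A/ℚ` with CM and every prime `p` there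
are an additive endomorphism `ψ` of `A(ℚ̄)`, `D < 0` with `ψ ∘ ψ = D`, and a non-trivial `χ : Γ_ℚ → {±1}` with
`ψ(σP) = χ(σ)·σψ(P)`, `ψ` visible on `A[p]`, such that **`χ(σ) = 1 ⟺ σ(√d_K) = √d_K`** in `ℚ̄`. Construction: pass
to the model `A' = C • A` with `a₁ = a₃ = 0` (`toCharNeTwoNF`), take the `ℚ`-isogeny `A' → A'^{(d_K)}` (Milne 1972 /
Burungale–Flach Cor. 2 and its non-maximal extension, the tree's `isIsogenous_quadraticTwist_cmFieldDiscrOfJ`), form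
`[√d_K] = ι ∘ φ` (`exists_visible_sqrt_twist_kummer_of_isogeny_quadraticTwist`) and transport back along the
`Γ_ℚ`-equivariant `A(ℚ̄) ≃ A'(ℚ̄)`. This supplies what `…CartanFieldCMTwist` left undone («that `ker χ` is `Γ_{ℚ(√D)}`
as a statement about `√D ∈ ℚ̄`»). [cite: Lang1987, Ch. 10 §4, Remark] [cite: SilvermanAdvancedTopics1994, Thm. II.2.2(a) and Prop. II.2.3.1] -/
theorem exists_visible_sqrt_twist_kummer_of_hasCM (A : WeierstrassCurve ℚ) [A.IsElliptic] (hCM : A.HasCM)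
    {p : ℕ} (hp : p.Prime) :
    ∃ (ψ : AddMonoid.End A.geomPoints) (D : ℤ) (χ : absoluteGaloisGroup ℚ →* ℤˣ),
      D < 0 ∧ (∀ P : A.geomPoints, ψ (ψ P) = D • P) ∧ (∃ σ : absoluteGaloisGroup ℚ, χ σ ≠ 1) ∧
      (∀ (σ : absoluteGaloisGroup ℚ) (P : A.geomPoints), ψ (σ • P) = ((χ σ : ℤˣ) : ℤ) • σ • ψ P) ∧
      (∃ P₀ : A.geomPoints, (p : ℤ) • P₀ = 0 ∧ ψ P₀ ≠ 0) ∧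
      ∀ σ : absoluteGaloisGroup ℚ, χ σ = 1 ↔
        σ • geomSqrt ((cmFieldDiscrOfJ A.j : ℤ) : ℚ) = geomSqrt ((cmFieldDiscrOfJ A.j : ℤ) : ℚ) := by
  letI : Invertible (2 : ℚ) := invertibleOfNonzero two_ne_zero
  set C : VariableChange ℚ := A.toCharNeTwoNF with hC
  have hj : (C • A).j = A.j := A.variableChange_j C
  have hCM' : (C • A).HasCM := (hasCM_iff_j_mem_holds (C • A)).mpr (hj ▸ (hasCM_iff_j_mem_holds A).mp hCM)
  set d : ℤ := cmFieldDiscrOfJ A.j with hd_def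
  have hdneg : d < 0 := cmFieldDiscrOfJ_neg_of_hasCM A hCM
  have hd0 : (d : ℚ) ≠ 0 := by exact_mod_cast hdneg.ne
  have hdsq : ∀ q : ℚ, (d : ℚ) ≠ q * q := fun q h => by
    have h1 : (0 : ℚ) ≤ q * q := mul_self_nonneg q
    have h2 : ((d : ℤ) : ℚ) < 0 := by exact_mod_cast hdneg
    rw [h] at h2
    exact absurd h2 (not_lt.mpr h1)
  have hiso : IsIsogenous (C • A) ((C • A).quadraticTwist (d : ℚ)) := by
    have := PrintCFram.RelativeAnchorTransfer.isIsogenous_quadraticTwist_cmFieldDiscrOfJ (C • A) hCM'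
    rwa [hj] at this
  obtain ⟨φ⟩ := hiso
  obtain ⟨ψ₁, D, χ, hD, hψψ, hχ, hrel, ⟨P₁, hP₁p, hP₁⟩, hiff⟩ :=
    exists_visible_sqrt_twist_kummer_of_isogeny_quadraticTwist hd0 φ hdsq hp
  -- transport along `T : A(ℚ̄) ≃+ (C • A)(ℚ̄)`
  set T : A.geomPoints ≃+ (C • A).geomPoints := geomPointsEquiv A C with hT_def
  have hT : ∀ (σ : absoluteGaloisGroup ℚ) (P : A.geomPoints), T (σ • P) = σ • T P := geomPointsEquiv_smul A C
  let ψ : AddMonoid.End A.geomPoints :=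
    T.symm.toAddMonoidHom.comp ((ψ₁ : (C • A).geomPoints →+ (C • A).geomPoints).comp T.toAddMonoidHom)
  have hψ : ∀ P : A.geomPoints, ψ P = T.symm (ψ₁ (T P)) := fun P => rfl
  refine ⟨ψ, D, χ, hD, fun P => ?_, hχ, fun σ P => ?_, ⟨T.symm P₁, ?_, ?_⟩, hiff⟩
  · rw [hψ, hψ, T.apply_symm_apply, hψψ, map_zsmul, T.symm_apply_apply]
  · rw [hψ, hψ, hT, hrel, map_zsmul, addEquiv_symm_smul T hT]
  · rw [← map_zsmul, hP₁p, map_zero]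
  · rw [hψ, T.apply_symm_apply]
    exact fun h => hP₁ (T.symm.map_eq_zero_iff.mp h)

end CM


end Summit.BirchSwinnertonDyer.BirchSwinnertonDyer.Theorems.EtaCartanField

end
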